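import Summits.AtomisticToContinuum.HydrodynamicLimit.Theses.JParityClosure
import Summits.AtomisticToContinuum.HydrodynamicLimit.Theorems.JParityClosureLocalSecondLawLedgerDefs
import Summits.AtomisticToContinuum.HydrodynamicLimit.Theorems.JParityClosureLocalSecondLawInitialLayer
import Summits.AtomisticToContinuum.HydrodynamicLimit.Theorems.JParityClosureLocalSecondLawLedger
import Summits.AtomisticToContinuum.HydrodynamicLimit.Theorems.LocalSecondLaw.Negative.FalseWithoutLLN
import Summits.AtomisticToContinuum.HydrodynamicLimit.Theorems.LocalSecondLaw.Negative.FalseWithoutSupport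
import Summits.AtomisticToContinuum.HydrodynamicLimit.Theorems.LocalSecondLaw.Negative.Tightness
import Summits.AtomisticToContinuum.HydrodynamicLimit.Theorems.LocalSecondLaw.Negative.RAfterN
import Summits.AtomisticToContinuum.HydrodynamicLimit.Theorems.ImplosionDichotomyHsEosLowDensity
import Summits.AtomisticToContinuum.HydrodynamicLimit.Theorems.LocalSecondLaw.Negative.EquilibriumL1
import Summits.AtomisticToContinuum.HydrodynamicLimit.Theorems.JParityClosureLocalSecondLawThermalHeatFluxBounds
import Summits.AtomisticToContinuum.HydrodynamicLimit.Theorems.JParityClosureLocalSecondLawEquilibriumConst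

/-!
# Line `exact-entropy-ledger-three-passivities` — crux `JParityClosure.LocalSecondLaw`
(stmt-AtomisticToContinuum-13081)

STATUS (lead prover-line-stmt-AtomisticToContinuum-13081-0, after waves 1–2, 2026-08-16): B `stub_initialLayer` and
L `stub_ledger` are CLOSED by landed tree theorems (`Theorems/JParityClosureLocalSecondLawInitialLayer{LLN,}.lean`,
`Theorems/JParityClosureLocalSecondLawLedger*.lean`, 17 files); the vocabulary is the tree module
`Theorems/JParityClosureLocalSecondLawLedgerDefs.lean`; F, P1, P2, P3 stay OPEN as registered (open mathematics, all τ)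
with LANDED typed reductions: F ⟸ fixed-time three-field LLN on `[0,τ]` + time-equicontinuity of `(m_r,e_r)`
(`regularRange_of_fieldLLN{,_euler}`, …RegularRange{Tools,Grid,Reduction}.lean); P1 ⟸ KineticIsotropyRate + StrainTightness
(`passivityKinetic_of_isotropy`, …KineticStress{Algebra,Strain,Regularity}.lean, …PassivityKineticOfIsotropy.lean);
P2 ⟸ CollisionalWorkEnskogLaw (weighted EvenStressEnskog) + P1's inputs (`passivityCollisional_of_enskog{,_weighted,_isotropy}`,
…CollisionalWorkRegularity/…CoarseFieldBounds/…PassivityCollisionalOfEnskog/…CollisionalWorkIntegrable.lean); P3 ⟸ CubicHeatFluxRate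
+ ThermalStrainTightness + CollisionalHeatLaw (`passivityThermal_of_closure`, …ThermalHeatFlux{Bounds,Regularity}.lean,
…PassivityThermalOfClosure.lean); Strain/ThermalStrain ⟸ CoarseBounds2r ⟸ (pre-shock) the same field LLN
(…StrainFromCoarseBounds/…StrainOfCoarseBounds/…CoarseBoundsOfFieldLLN.lean); the conditional compositions are LANDED in
`Theorems/JParityClosureLocalSecondLawComposition.lean` (`localSecondLaw_of_passivities : F → P1 → P2 → P3 → LocalSecondLaw`,
`localSecondLaw_of_inputs`, `localSecondLaw_of_sixInputs`).  Every integral in `T₁, T₂, T₃, entropyFunctional, bdry` is proved HONEST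
on `Regular`.  Line report: `Cruxes/LocalSecondLaw/NOTES.md`.

Checked skeleton of the crux idea `exact-entropy-ledger-three-passivities`
(`Cruxes/LocalSecondLaw/Ideas/exact-entropy-ledger-three-passivities.md`, ideator 3), sharpened by the round-1
triage panel (`TRIAGE-r1-{1,2,3}.md`: pass ×3).  Line card: `Cruxes/LocalSecondLaw/Lines/exact-entropy-ledger-three-passivities.md`.

THE LINE.  The crux functional `𝓕(z) = I(z) + ∫ H(ρ(0),θ(0)) φ(0)` (`entropyFunctional` + Euler boundary term) is a
functional of the cone-mollified conserved fields `U_r = (ρ_r, m_r, e_r)` of ONE hard-sphere trajectory, and along one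
trajectory these fields obey EXACT balance laws: same-kernel continuity `∂ₛρ_r + div m_r = 0`, free-transport
momentum/energy hierarchies between collisions, and at each collision a jump of `(m_r, e_r)` which is an exact
divergence (Hardy's bond `b(xᵢ,·) − b(xⱼ,·) = −div ∫₀¹ (xᵢ−xⱼ) b(xⱼ+λ(xᵢ−xⱼ),·) dλ`).  Chain-ruling the hard-sphere
entropy `H = −ρ(3/2 log θ − log ρ − f_ex(ρσ³))` along them — entropy/entropy-flux compatibility of the hs-Euler pair
(`p = hsPressure`) for the smooth part, and for the jumps a first-order expansion about the POST-collisional state whose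
second-order remainder is SIGNED (`H` is convex in `(m, e)` at fixed `ρ`; with `φ ≥ 0` it only helps) — gives the
PATHWISE LEDGER INEQUALITY, on every good orbit whose coarse fields stay in a regular range:

  `𝓕_r(z) := I(z) + ∫ H(ρ_r(z),θ_r(z)) φ(0)  ≥  T1(z) + T2(z) + T3(z)`,

  `T1 = −∫∫ (φ/θ_r) Σ^dev_r : ∇u_r`                      (kinetic-anisotropy work; `Σ^dev_r` the traceless peculiar stress),
  `T2 = −∫∫ (φ/θ_r) [P^c_r − (p_hs − ρ_rθ_r)𝟙] : ∇u_r`   (collisional-stress excess work; `P^c_r` Hardy's PSD contact stress),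
  `T3 = +∫∫ ∇(φ/θ_r) · (q^kin_r + q^c_r)`                 (heat-current pairing; kinetic cubic moment + collisional transfer),

all three explicit finite-`N` statistics (`T1`, `T2`, `T3` below, over `rhoC/momC/thetaC/cone` of
`Theorems/LocalSecondLaw/Negative/Functional.lean`, the crux's own `Torus.partialDeriv`, `reflectVel`, `sepVec`,
`collisionTimes`, `hsPressure`).  The crux then follows from SIX registered stubs by a union bound:

* `stub_initialLayer`  (B)  — the Euler boundary term dominates the particle one at `t = 0`:
  `∫H(ρ(0),θ(0))φ(0) ≥ ∫H(ρ_r,θ_r)φ(0) − η` in probability (the `t = 0` LLN upgraded to uniform-in-`x` at fixed `r`,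
  continuity of `f_ex` in the band).  [M–L, provable now with the tree's statics LLN]
* `stub_ledger`        (L)  — the pathwise ledger inequality above (deterministic; a.e. calculus for the Lipschitz cone
  fields, Stieltjes integration by parts in `s`, Hardy's bond, convexity of `H` in `(m,e)`).  [L, provable now]
* `stub_regularRange`  (F)  — floors and cap in probability at fixed `r`: `c ≤ ρ_r`, `ρ_rσ³ ≤ η₁`, `c ≤ θ_r` on
  `[0,τ] × 𝕋³` and `z ∈ good`, with `c = c(τ,δ)` chosen BEFORE `r₀` (triage r1-1/2/3: "make the floor a named stub").
  [L–open; pre-shock = DensityCap ∧ DiluteSelfConsistency ∧ no-cold-spots]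
* `stub_passivityKinetic`     (P1) — `P(Regular ∧ T1 < −η) ≤ δ`.  Pre-shock ⟸ cruxes 2+4 + ParityRigidity +
  KineticEnergyTails (Maxwellian limit law + quadratic UI ⇒ isotropic stress ⇒ `Σ^dev_r → 0`); post-shock it is the
  card's (N3) COMPRESSIVITY bet (unresolved anisotropy does no positive work on resolved strain).  [open]
* `stub_passivityCollisional` (P2) — `P(Regular ∧ T2 < −η) ≤ δ`.  ⟸ EvenStressEnskog (crux 3, SAME marks
  `((w−v)·n̂)₊ n̂ₖn̂ₗ`) + HsEosLowDensity; the resibois-offset-identity card is its worked-out configurational half.  [open]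
* `stub_passivityThermal`     (P3) — `P(Regular ∧ T3 < −η) ≤ δ`: the WEAK CUBIC heat-flux closure (N1) + vanishing
  collisional heat transfer (N2) the card shows the crux IMPLIES (the `c/V³` stream witness); HighMomentumCutoff class;
  producer on the board: card termwise-even-channel-mesoscale.  [open; the line's hardest stub]

`LocalSecondLaw_of : HsEosLowDensity → F → P1 → P2 → P3 → LocalSecondLaw` is PROVED below (no `sorry`; B and L are
LANDED tree theorems since cycle 1 and are discharged inside the proof):
thresholds `σ₀ := min`, `η₁ := η₀/2` from the EOS band, `c` from F, `r₀ := min`, `N₀ := max`, and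
`{𝓕 < −η} ⊆ {bdry mismatch > η/4} ∪ Regularᶜ ∪ ⋃ᵢ {Regular ∧ Tᵢ < −η/4}` by the ledger, then `measure_union_le`.
`HsEosLowDensity` (stmt-0768) is a route item BY NAME and is PROVED in the tree (`Theorems.hsEosLowDensity_proof`,
p75216) — the wiring `example` at the end discharges it.

DISPROOF USED (`Cruxes/LocalSecondLaw/Disproof.lean`, verdict NO KILL; landed `Theorems/LocalSecondLaw/Negative/*`,
IMPORTED here and cited in §Checks): `localSecondLaw_false_without_lln` — honoured: the `t = 0` tie
`TendstoHydroFieldsAt … 0` is a hypothesis of B (and of F, P1–P3) and is threaded to them by `LocalSecondLaw_of`; the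
Euler PDE beyond `t = 0` is used by NO stub except through the frame (Disproof (a) second bullet);
`localSecondLaw_false_without_support` — honoured: the support condition is a hypothesis of L (no terminal boundary term in
the Stieltjes integration by parts) and of P1–P3; `not_localSecondLawGapAt` / `not_localSecondLawStrictGap` (tightness at
global equilibrium) — respected: every passivity claims `Tᵢ ≥ −η`, never a positive gap, and at equilibrium
`T1 = T2 = T3 → 0`; `not_localSecondLawRAfterN` — respected: every stub keeps `∃ r₀ ∀ r ∃ N₀ ∀ N`, and F is false for
`2r < ε_N` (`θ_r ≡ 0`, `Hs_rhoC_thetaC_eq_zero_of_sep`), as it must be; Disproof §(b) "no pathwise LOWER bound, cold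
balls" — quarantined in F (floors) and in the guard-free regular range of L; §(d) "continuity of `f_ex` needed even at
equilibrium" — B, L, P2 take the EOS band (`EosBand`, = HsEosLowDensity's content) as hypothesis.  `-- Targets`: none yet.
`ledger negatives --problem AtomisticToContinuum` (12): 9236/9238 (r → 0 before N → ∞) — not restated, all stubs are
fixed-`r`-then-`N`; 9168 (untied ∀-solution frame) — tie kept; 14607 (exponential cubic-tail currency) — P3 asks a weak-form
limit, no rate, no exponential moment; 13479/11470/14288 unrelated.
-/

noncomputable section

namespace Summit.AtomisticToContinuum.HydrodynamicLimit.Cruxes.LocalSecondLaw.ExactEntropyLedgerThreePassivities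

open scoped BigOperators Topology Classical MeasureTheory ENNReal InnerProductSpace
open Filter Set MeasureTheory
open Literature.MathematicalPhysics.KineticTheory
open Literature.Analysis.FluidPDE
open Summit.AtomisticToContinuum.HydrodynamicLimit.Theses
open Summit.AtomisticToContinuum.HydrodynamicLimit.Theorems.LocalSecondLawNegative
open Summit.AtomisticToContinuum.HydrodynamicLimit.Theorems.LocalSecondLawLedger

/-! ## Vocabulary of the ledger — LANDED

Since cycle 1 the line's vocabulary (`Flow`, `Phase`, `pD`, `tproj`, `uC`, `devC`, `qkinC`, `pexC`, `nrm`, `vin`, `impulse`,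
`bondC`, `collSum`, `T₁`, `T₂smooth`, `T₂coll`, `T₂`, `T₃kin`, `T₃coll`, `T₃`, `bdry`, `Regular`, `EosBand`) is the tree module
`Theorems/JParityClosureLocalSecondLawLedgerDefs.lean` (p85068; namespace `…Theorems.LocalSecondLawLedger`, texts byte-identical
to the round-1 skeleton's), opened above; `cone r y x₀`, `rhoC`, `momC`, `kinC`, `thetaC`, `Hs`, `entropyFunctional` are the
LANDED pieces of the crux functional (`Theorems/LocalSecondLaw/Negative/Functional.lean`, definitionally the crux's `let`-tower). -/

variable {N : ℕ}

/-! ## The six registered stubs (statement `Prop`s `Stubs.stub_*`, then the sorried theorems `stub_*` verbatim) -/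

/-- **B · initial layer** (`stub_initialLayer`).  In the crux's frame at `t = 0`: given the EOS band, for profiles,
`σ < σ₀(profiles, η₀)`, a classical hs-Euler solution TIED to the data by the `t = 0` LLN, and a smooth non-negative
space–time test function, the Euler boundary term dominates the particle one up to `η`:
`P( ∫H(ρ(0),θ(0))φ(0) < ∫H(ρ_r(Φ₀z),θ_r(Φ₀z))φ(0) − η ) ≤ δ` for `r < r₀`, `N ≥ N₀(r)`.
WHY TRUE: the `t = 0` LLN (`TendstoHydroFieldsAt … 0`, weak, per test function) upgrades at fixed `r` to uniform-in-`x`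
convergence in probability of `(ρ_r, m_r, e_r)(z)` to the cone-mollified Euler data (finite net on the compact torus +
`3/(πr⁴)`-Lipschitz cone fields with energy-tight constants — the GridUpgrade pattern of `DensityCap/Lines/weak-lln-upgrade`);
the mollified data tend to `(ρ, ρu, E)(0,·)` uniformly as `r → 0` (continuity); `Hs` is continuous on `{ρ>0, θ>0}` once
`f_ex` is continuous at `ρ(0,x)σ³ < η₀`, which `σ₀` enforces through the identified LLN limit (`ρ(0,·)` = the static
local-Gibbs density, tree `…StaticsLLN`, bounded by the profiles uniformly in small `σ`).  One-sided is all the crux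
needs (Disproof: `localSecondLaw_false_without_lln` — the tie is consumed HERE).  Size M–L, provable now.
Leans on: `TendstoHydroFieldsAt`, `IsHardSphereEulerSolution.{density_pos,temperature_pos,smooth_*}`, tree statics LLN
(`Theorems.ImplosionDichotomyPolynomialCompressionStaticsLLN`, `localGibbs_lln_holds`), `Negative/HomogeneousLLN`,
`continuous_cone`, `integral_cone_eq_one` (ConeNormalisation), `Hs`, `EosBand`. -/
def Stubs.stub_initialLayer : Prop :=
  ∀ (η₀ : ℝ) (F : ℝ → ℝ), EosBand η₀ F →
  ∀ (a₀ θ₀ : T3 → ℝ) (u₀ : T3 → V3), Continuous a₀ → Continuous θ₀ → Continuous u₀ →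
    (∀ x, 0 < a₀ x) → (∀ x, 0 < θ₀ x) → ∃ σ₀ : ℝ, 0 < σ₀ ∧ ∀ σ : ℝ, 0 < σ → σ < σ₀ →
    ∀ (T : ℝ) (ρ θ : ℝ → T3 → ℝ) (u : ℝ → T3 → V3), IsHardSphereEulerSolution σ T ρ u θ →
    ∀ Φ : (N : ℕ) → Flow σ N,
    TendstoHydroFieldsAt (fun N => localGibbsLaw σ a₀ u₀ θ₀ N (Φ N)) Φ ρ u θ 0 → 0 < T →
    ∀ φ : ℝ → T3 → ℝ, Literature.Analysis.FunctionSpaces.Torus.IsSmoothSpaceTimeOn Set.univ φ →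
    (∀ s x, 0 ≤ φ s x) →
    ∀ η δ : ℝ, 0 < η → 0 < δ → ∃ r₀ : ℝ, 0 < r₀ ∧ ∀ r : ℝ, 0 < r → r < r₀ → ∃ N₀ : ℕ, ∀ N : ℕ, N₀ ≤ N →
      localGibbsLaw σ a₀ u₀ θ₀ N (Φ N)
          {z | (∫ x : T3, Hs σ (ρ 0 x) (θ 0 x) * φ 0 x) < bdry σ r (φ 0) (Φ N) z - η}
        ≤ ENNReal.ofReal δ

/-- Registered stub B (`Stubs.stub_initialLayer`, verbatim): CLOSED — the landed tree theorem. -/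
theorem stub_initialLayer :
  ∀ (η₀ : ℝ) (F : ℝ → ℝ), EosBand η₀ F →
  ∀ (a₀ θ₀ : T3 → ℝ) (u₀ : T3 → V3), Continuous a₀ → Continuous θ₀ → Continuous u₀ →
    (∀ x, 0 < a₀ x) → (∀ x, 0 < θ₀ x) → ∃ σ₀ : ℝ, 0 < σ₀ ∧ ∀ σ : ℝ, 0 < σ → σ < σ₀ →
    ∀ (T : ℝ) (ρ θ : ℝ → T3 → ℝ) (u : ℝ → T3 → V3), IsHardSphereEulerSolution σ T ρ u θ →
    ∀ Φ : (N : ℕ) → Flow σ N,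
    TendstoHydroFieldsAt (fun N => localGibbsLaw σ a₀ u₀ θ₀ N (Φ N)) Φ ρ u θ 0 → 0 < T →
    ∀ φ : ℝ → T3 → ℝ, Literature.Analysis.FunctionSpaces.Torus.IsSmoothSpaceTimeOn Set.univ φ →
    (∀ s x, 0 ≤ φ s x) →
    ∀ η δ : ℝ, 0 < η → 0 < δ → ∃ r₀ : ℝ, 0 < r₀ ∧ ∀ r : ℝ, 0 < r → r < r₀ → ∃ N₀ : ℕ, ∀ N : ℕ, N₀ ≤ N →
      localGibbsLaw σ a₀ u₀ θ₀ N (Φ N)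
          {z | (∫ x : T3, Hs σ (ρ 0 x) (θ 0 x) * φ 0 x) < bdry σ r (φ 0) (Φ N) z - η}
        ≤ ENNReal.ofReal δ :=
  -- CLOSED (cycle 1, p92981 + p87291): `Theorems/JParityClosureLocalSecondLawInitialLayer{LLN,}.lean`
  Summit.AtomisticToContinuum.HydrodynamicLimit.Theorems.LocalSecondLawLedger.stub_initialLayer

/-- **L · the pathwise entropy ledger** (`stub_ledger`; deterministic, the line's lever).  Given the EOS band, a cap
`η₁ < η₀`, a floor `c > 0`, `σ, r, τ > 0` and a smooth `φ ≥ 0` vanishing from some `τ' < τ` on: for EVERY `N`, flow `Φ`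
and phase point `z` in the regular event,
`T1 z + T2 z + T3 z ≤ entropyFunctional σ r τ φ Φ z + ∫ H(ρ_r(Φ₀z), θ_r(Φ₀z)) φ(0)`.
WHY TRUE (paper proof, card + triage hand checks ×3): (i) on a good orbit positions are continuous and piecewise free,
so for each `x₀` the cone fields `U_r(s,x₀)` are Lipschitz between the finitely many collision times in `[0,τ]`, with
jumps of `(m_r, e_r)` only; Stieltjes integration by parts in `s` (`φ(τ'..) = 0`: no terminal term — Disproof
`localSecondLaw_false_without_support`) gives `𝓕_r = −∫∫φ(∂ₛ^{ac}H + div(Hu_r)) − ∑_c ∫ φ ΔH_c`; (ii) between collisions the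
empirical moments obey the free hierarchy `∂ρ_r = −div m_r` (same kernel, `∇ᵧb = −∇ₓ₀b`), `∂m_r = −div Σ^kin_r`,
`∂e_r = −div Q^kin_r` a.e., and the entropy/entropy-flux compatibility of `(H, Hu)` for the hs-Euler flux with
`p = hsPressure = ρθ + p_ex` (Gibbs relation, exact on the band where `deriv f_ex = F'`) leaves
`∂H + div(Hu) = θ⁻¹[Σ^dev:∇u − p_ex div u + div q^kin]` a.e. (Rademacher for the Lipschitz cone fields; `partialDeriv` is
the a.e. derivative); one integration by parts in `x` turns `−(φ/θ)div q^kin` into `+∇(φ/θ)·q^kin`; (iii) at a collision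
`ΔU = (0, Δm, Δe)` with `Δm = (N+1)⁻¹(bᵢ − bⱼ)Δvᵢ`, `Δe = (N+1)⁻¹(bᵢ − bⱼ)Δvᵢ·V̄ᵢ`, `V̄ᵢ = (vᵢ⁻+vᵢ⁺)/2`; expanding about
the POST-collisional state, `ΔH = DH(U⁺)·ΔU − R₂` with `R₂ = ∫₀¹(1−λ)D²H[ΔU,ΔU] ≥ 0` because at fixed `ρ`
`D²H[ΔU,ΔU] = |Δm|²/(ρθ) + (2/(3ρθ²))(u·Δm − Δe)² ≥ 0` along the segment (`θ` concave in `(m,e)`, so `θ ≥ c` there);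
with `φ ≥ 0` the remainder only INCREASES `𝓕_r`; (iv) `DH(U⁺)·ΔU = (N+1)⁻¹(bᵢ−bⱼ)θ⁻¹Δvᵢ·(u−V̄ᵢ)`, Hardy's bond
`bᵢ − bⱼ = −div(sepVec·b̄)` (`xⱼ + proj(sepVec xᵢ xⱼ) = xᵢ` on the torus) and one more integration by parts give exactly
`T₂coll + T₃coll` (`Δvᵢ = a n̂`, `Δvᵢ·(V̄ᵢ − u) = (a/2)n̂·(v⁻+w⁻−2u)`; both ordered pairs give the same term, whence the `1/2`).
NSF sanity check (triage): on Navier–Stokes–Fourier fields the three terms are `2μ|S°|²φ/θ`, `ζ(div u)²φ/θ`,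
`κ|∇θ|²φ/θ² + ∇φ·q/θ`.  Size L (heavy but classical a.e. calculus), provable now.
Leans on: `IsHardSphereTrajectory.{free,binary,locFinite,pos_continuous}`, `freeFlight_apply`, `Torus.geometry_translate`,
`Torus.geometry_sepVec`, `reflectVel`, `integral_empiricalMeasure`, `Torus.integral_inner_gradient_eq_neg_integral_mul_divergence`
(to be extended to Lipschitz integrands), `hsPressure`, `hsCompressibility`, `EosBand`; EmpiricalEnskogIdentity (13086) is
the same collision bookkeeping with `b = cone r · x₀`, `c ∈ {1, v, |v|²/2}`. -/
def Stubs.stub_ledger : Prop :=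
  ∀ (η₀ : ℝ) (F : ℝ → ℝ), EosBand η₀ F →
  ∀ (η₁ c σ r τ : ℝ), η₁ < η₀ → 0 < c → 0 < σ → 0 < r → 0 < τ →
  ∀ φ : ℝ → T3 → ℝ, Literature.Analysis.FunctionSpaces.Torus.IsSmoothSpaceTimeOn Set.univ φ →
    (∀ s x, 0 ≤ φ s x) → (∃ τ' : ℝ, τ' < τ ∧ ∀ s, τ' ≤ s → ∀ x, φ s x = 0) →
  ∀ (N : ℕ) (Φ : Flow σ N) (z : Phase N), Regular σ r τ c η₁ Φ z →
    T₁ σ r τ φ Φ z + T₂ σ r τ φ Φ z + T₃ σ r τ φ Φ z ≤ entropyFunctional σ r τ φ Φ z + bdry σ r (φ 0) Φ z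

/-- Registered stub L (`Stubs.stub_ledger`, verbatim): CLOSED — the landed tree theorem. -/
theorem stub_ledger :
  ∀ (η₀ : ℝ) (F : ℝ → ℝ), EosBand η₀ F →
  ∀ (η₁ c σ r τ : ℝ), η₁ < η₀ → 0 < c → 0 < σ → 0 < r → 0 < τ →
  ∀ φ : ℝ → T3 → ℝ, Literature.Analysis.FunctionSpaces.Torus.IsSmoothSpaceTimeOn Set.univ φ →
    (∀ s x, 0 ≤ φ s x) → (∃ τ' : ℝ, τ' < τ ∧ ∀ s, τ' ≤ s → ∀ x, φ s x = 0) →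
  ∀ (N : ℕ) (Φ : Flow σ N) (z : Phase N), Regular σ r τ c η₁ Φ z →
    T₁ σ r τ φ Φ z + T₂ σ r τ φ Φ z + T₃ σ r τ φ Φ z ≤ entropyFunctional σ r τ φ Φ z + bdry σ r (φ 0) Φ z :=
  -- CLOSED (cycle 1, p122449 after 16 layer files p95100 … p121623): `Theorems/JParityClosureLocalSecondLawLedger*.lean`
  Summit.AtomisticToContinuum.HydrodynamicLimit.Theorems.LocalSecondLawLedger.stub_ledger

/-- **F · regular range in probability** (`stub_regularRange`; the floor/cap item the triage panel asked to be NAMED).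
In the crux's frame, for every cap level `η₁ > 0`: `σ < σ₀(η₁, profiles)`, any tied classical solution and flows, every
horizon `τ` and `δ`: there is a floor `c = c(τ, δ, …) > 0`, chosen BEFORE the resolution, such that for `r < r₀`,
`N ≥ N₀(r)` the orbit is good and `c ≤ ρ_r`, `ρ_rσ³ ≤ η₁`, `c ≤ θ_r` on all of `[0,τ] × 𝕋³`, with probability `≥ 1 − δ`.
WHY TRUE / WHERE IT MIGHT FAIL: `goodᶜ` is law-null (`localGibbsLaw ≪ liouville`, `measure_compl_good`).  PRE-SHOCK
(`τ < T`) the cap is `DensityCap` (crux 6, 13082) + `DiluteSelfConsistency` (3091) and the floors are the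
no-concentration / kinetic-range statements already on the board (EntropyBookkeeping.NoConcentration 4517,
GermanoSplitLES.KineticRangeControl) — uniform-in-`(s,x)` LLN-type control, `c ≍ min(inf ρ, inf θ)/2` independent of `r`.
POST-SHOCK (the crux has no `τ < T`) it is a BET: no macroscopic vacuum bubble or absolute-zero spot of size `r`, and no
compression beyond `η₁/σ³`, ever forms with positive probability on `[0,τ]` — the compression half carries the implosion
hazard of 3091 (DenseExcursion); honest and shared, not new.  It is FALSE with `∃ N₀` before `∀ r`
(`Negative/RAfterN`: `θ_r ≡ 0` once `2r < ε_N`), which is why `N₀ = N₀(r)`.  Size L–open.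
Leans on: `DensityCap`, `DiluteSelfConsistency` (route items), `TendstoHydroFieldsAt`, `rhoC_le_const`, `Hs_rhoC_thetaC_eq_zero_of_sep`
(what to avoid), `HardSphereFlow.measure_compl_good`. -/
def Stubs.stub_regularRange : Prop :=
  ∀ η₁ : ℝ, 0 < η₁ →
  ∀ (a₀ θ₀ : T3 → ℝ) (u₀ : T3 → V3), Continuous a₀ → Continuous θ₀ → Continuous u₀ →
    (∀ x, 0 < a₀ x) → (∀ x, 0 < θ₀ x) → ∃ σ₀ : ℝ, 0 < σ₀ ∧ ∀ σ : ℝ, 0 < σ → σ < σ₀ →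
    ∀ (T : ℝ) (ρ θ : ℝ → T3 → ℝ) (u : ℝ → T3 → V3), IsHardSphereEulerSolution σ T ρ u θ →
    ∀ Φ : (N : ℕ) → Flow σ N,
    TendstoHydroFieldsAt (fun N => localGibbsLaw σ a₀ u₀ θ₀ N (Φ N)) Φ ρ u θ 0 → 0 < T →
    ∀ τ : ℝ, 0 < τ → ∀ δ : ℝ, 0 < δ →
    ∃ c : ℝ, 0 < c ∧ ∃ r₀ : ℝ, 0 < r₀ ∧ ∀ r : ℝ, 0 < r → r < r₀ → ∃ N₀ : ℕ, ∀ N : ℕ, N₀ ≤ N →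
      localGibbsLaw σ a₀ u₀ θ₀ N (Φ N) {z | ¬ Regular σ r τ c η₁ (Φ N) z} ≤ ENNReal.ofReal δ

/-- Registered stub F (`Stubs.stub_regularRange`, verbatim): the `sorry` to be discharged. -/
theorem stub_regularRange :
  ∀ η₁ : ℝ, 0 < η₁ →
  ∀ (a₀ θ₀ : T3 → ℝ) (u₀ : T3 → V3), Continuous a₀ → Continuous θ₀ → Continuous u₀ →
    (∀ x, 0 < a₀ x) → (∀ x, 0 < θ₀ x) → ∃ σ₀ : ℝ, 0 < σ₀ ∧ ∀ σ : ℝ, 0 < σ → σ < σ₀ →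
    ∀ (T : ℝ) (ρ θ : ℝ → T3 → ℝ) (u : ℝ → T3 → V3), IsHardSphereEulerSolution σ T ρ u θ →
    ∀ Φ : (N : ℕ) → Flow σ N,
    TendstoHydroFieldsAt (fun N => localGibbsLaw σ a₀ u₀ θ₀ N (Φ N)) Φ ρ u θ 0 → 0 < T →
    ∀ τ : ℝ, 0 < τ → ∀ δ : ℝ, 0 < δ →
    ∃ c : ℝ, 0 < c ∧ ∃ r₀ : ℝ, 0 < r₀ ∧ ∀ r : ℝ, 0 < r → r < r₀ → ∃ N₀ : ℕ, ∀ N : ℕ, N₀ ≤ N →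
      localGibbsLaw σ a₀ u₀ θ₀ N (Φ N) {z | ¬ Regular σ r τ c η₁ (Φ N) z} ≤ ENNReal.ofReal δ := by
  sorry

/-- **P1 · passivity of the kinetic anisotropy** (`stub_passivityKinetic`; the card's PassivityT1, incl. (N3)).  In the
crux's frame, for every floor/cap `(c, η₁)`: `P( Regular ∧ T1 < −η ) ≤ δ` for `r < r₀(c, η, δ, …)`, `N ≥ N₀(r)` — the
unresolved kinetic anisotropy `Σ^dev_r` does asymptotically no positive work on the resolved strain `∇u_r` weighted by
`φ/θ_r`.  WHY PLAUSIBLE: PRE-SHOCK `Σ^dev_r → 0` in `L¹` in probability (`N → ∞` at fixed `r`, then `r → 0`) from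
OddContactSymmetry + RateFloor ⇒ vanishing even production ⇒ ParityRigidity ⇒ Maxwellian limit law, upgraded to
"isotropic kinetic STRESS" by KineticEnergyTails — exactly ParityInBand step (ii) of the route; against the bounded weight
`(φ/θ_r)∇u_r` (on Regular `|∇u_r| ≤ C(c, ke)/r`, and the resolved part of `Σ^dev_r` is `O(r²|∇u|²)`) this gives `T1 → 0`.
POST-SHOCK it is the COMPRESSIVITY BET (N3, no mechanism beyond kinematic slaving — triage r1-2): at a smeared shock
`Σ^dev_r ≈ ρ⟨δu⊗δu⟩_r` and `−Σ^dev:∇u ≥ 0` iff the jump is compressive; strain acting on an isotropic tensor creates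
`Σ^dev(dt) = −2ρθS^dev dt`, i.e. the right sign at birth.  Velocity reversal flips `T1` — it is an in-probability
statement about forward local-Gibbs evolutions, not a sure one (VelocityReversalBarrier respected).  Size: open
(pre-shock L given cruxes 2, 4 and the supports; post-shock open-problem).
Leans on: `OddContactSymmetry` (13078), `RateFloor` (13080), `ParityRigidity` (13084), `KineticEnergyTails` (13087),
`CollisionTightness` (13085), `EmpiricalEnskogIdentity` (13086), `ParitySplit` (13083). -/
def Stubs.stub_passivityKinetic : Prop :=
  ∀ (a₀ θ₀ : T3 → ℝ) (u₀ : T3 → V3), Continuous a₀ → Continuous θ₀ → Continuous u₀ →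
    (∀ x, 0 < a₀ x) → (∀ x, 0 < θ₀ x) → ∃ σ₀ : ℝ, 0 < σ₀ ∧ ∀ σ : ℝ, 0 < σ → σ < σ₀ →
    ∀ (T : ℝ) (ρ θ : ℝ → T3 → ℝ) (u : ℝ → T3 → V3), IsHardSphereEulerSolution σ T ρ u θ →
    ∀ Φ : (N : ℕ) → Flow σ N,
    TendstoHydroFieldsAt (fun N => localGibbsLaw σ a₀ u₀ θ₀ N (Φ N)) Φ ρ u θ 0 → 0 < T →
    ∀ τ : ℝ, 0 < τ → ∀ φ : ℝ → T3 → ℝ, Literature.Analysis.FunctionSpaces.Torus.IsSmoothSpaceTimeOn Set.univ φ →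
    (∀ s x, 0 ≤ φ s x) → (∃ τ' : ℝ, τ' < τ ∧ ∀ s, τ' ≤ s → ∀ x, φ s x = 0) →
    ∀ c η₁ : ℝ, 0 < c →
    ∀ η δ : ℝ, 0 < η → 0 < δ → ∃ r₀ : ℝ, 0 < r₀ ∧ ∀ r : ℝ, 0 < r → r < r₀ → ∃ N₀ : ℕ, ∀ N : ℕ, N₀ ≤ N →
      localGibbsLaw σ a₀ u₀ θ₀ N (Φ N)
          {z | Regular σ r τ c η₁ (Φ N) z ∧ T₁ σ r τ φ (Φ N) z < -η}
        ≤ ENNReal.ofReal δ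

/-- Registered stub P1 (`Stubs.stub_passivityKinetic`, verbatim): the `sorry` to be discharged. -/
theorem stub_passivityKinetic :
  ∀ (a₀ θ₀ : T3 → ℝ) (u₀ : T3 → V3), Continuous a₀ → Continuous θ₀ → Continuous u₀ →
    (∀ x, 0 < a₀ x) → (∀ x, 0 < θ₀ x) → ∃ σ₀ : ℝ, 0 < σ₀ ∧ ∀ σ : ℝ, 0 < σ → σ < σ₀ →
    ∀ (T : ℝ) (ρ θ : ℝ → T3 → ℝ) (u : ℝ → T3 → V3), IsHardSphereEulerSolution σ T ρ u θ →
    ∀ Φ : (N : ℕ) → Flow σ N,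
    TendstoHydroFieldsAt (fun N => localGibbsLaw σ a₀ u₀ θ₀ N (Φ N)) Φ ρ u θ 0 → 0 < T →
    ∀ τ : ℝ, 0 < τ → ∀ φ : ℝ → T3 → ℝ, Literature.Analysis.FunctionSpaces.Torus.IsSmoothSpaceTimeOn Set.univ φ →
    (∀ s x, 0 ≤ φ s x) → (∃ τ' : ℝ, τ' < τ ∧ ∀ s, τ' ≤ s → ∀ x, φ s x = 0) →
    ∀ c η₁ : ℝ, 0 < c →
    ∀ η δ : ℝ, 0 < η → 0 < δ → ∃ r₀ : ℝ, 0 < r₀ ∧ ∀ r : ℝ, 0 < r → r < r₀ → ∃ N₀ : ℕ, ∀ N : ℕ, N₀ ≤ N →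
      localGibbsLaw σ a₀ u₀ θ₀ N (Φ N)
          {z | Regular σ r τ c η₁ (Φ N) z ∧ T₁ σ r τ φ (Φ N) z < -η}
        ≤ ENNReal.ofReal δ := by
  sorry

/-- **P2 · passivity of the collisional-pressure excess** (`stub_passivityCollisional`; the card's PassivityT2).
Given the EOS band and a cap `η₁ < η₀`, in the crux's frame: `P( Regular ∧ T2 < −η ) ≤ δ` eventually — the Hardy
contact stress `P^c_r` does asymptotically no LESS work on the resolved strain than the thermodynamic excess pressure
`ρ_rθ_r(Z−1)𝟙`.  WHY PLAUSIBLE: the collisional marks of `T₂coll` are `a n̂ₖn̂ₗ = Ξ_P^{kl}` of EvenStressEnskog (crux 3,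
13079) weighted by the configuration-dependent but (on Regular) bounded, `r⁻⁴`-Lipschitz weights `(φ/θ_r)∂ₖu_{r,l} b̄`;
a finite-net / equicontinuity step (triage r1-2 caveat (d)) reduces to finitely many fixed continuous `χ`, for which
crux 3 gives `K_N[χ Ξ_P^{kl}] − σ³∫∫χ Y B_r^{kl} → 0`; with isotropic second moments (P1's input, cruxes 2+4) and
`ρθ(Z−1) = σ³Y·B` (HsEosLowDensity, `Y = (3/2π)f_ex′`) the Enskog value cancels `T₂smooth` exactly — the
resibois-offset-identity card is this computation in surprisal dress (triage: checked by hand ×2).  The `O(ε)` offset of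
the bond (`b̄` vs `b(xᵢ)`) is `O(ε/r)`.  Sign mechanism valid through shocks: `P^c − p_ex𝟙 ≈ −ϖ(div u)(…)` (bulk-viscous,
dissipative); the one plausible wound (triage r1-1 falsifier (iii)) is a lagging contact value in re-expansion behind a
shock.  Size: open (⟸ crux 3 + P1's inputs pre-shock; bet post-shock).
Leans on: `EvenStressEnskog` (13079), `HsEosLowDensity` (0768, proved), `DensityCap` (13082), `CollisionTightness` (13085),
`hsPressure`, `hsCompressibility`, `EosBand`. -/
def Stubs.stub_passivityCollisional : Prop :=
  ∀ (η₀ : ℝ) (F : ℝ → ℝ), EosBand η₀ F → ∀ η₁ : ℝ, 0 < η₁ → η₁ < η₀ →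
  ∀ (a₀ θ₀ : T3 → ℝ) (u₀ : T3 → V3), Continuous a₀ → Continuous θ₀ → Continuous u₀ →
    (∀ x, 0 < a₀ x) → (∀ x, 0 < θ₀ x) → ∃ σ₀ : ℝ, 0 < σ₀ ∧ ∀ σ : ℝ, 0 < σ → σ < σ₀ →
    ∀ (T : ℝ) (ρ θ : ℝ → T3 → ℝ) (u : ℝ → T3 → V3), IsHardSphereEulerSolution σ T ρ u θ →
    ∀ Φ : (N : ℕ) → Flow σ N,
    TendstoHydroFieldsAt (fun N => localGibbsLaw σ a₀ u₀ θ₀ N (Φ N)) Φ ρ u θ 0 → 0 < T →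
    ∀ τ : ℝ, 0 < τ → ∀ φ : ℝ → T3 → ℝ, Literature.Analysis.FunctionSpaces.Torus.IsSmoothSpaceTimeOn Set.univ φ →
    (∀ s x, 0 ≤ φ s x) → (∃ τ' : ℝ, τ' < τ ∧ ∀ s, τ' ≤ s → ∀ x, φ s x = 0) →
    ∀ c : ℝ, 0 < c →
    ∀ η δ : ℝ, 0 < η → 0 < δ → ∃ r₀ : ℝ, 0 < r₀ ∧ ∀ r : ℝ, 0 < r → r < r₀ → ∃ N₀ : ℕ, ∀ N : ℕ, N₀ ≤ N →
      localGibbsLaw σ a₀ u₀ θ₀ N (Φ N)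
          {z | Regular σ r τ c η₁ (Φ N) z ∧ T₂ σ r τ φ (Φ N) z < -η}
        ≤ ENNReal.ofReal δ

/-- Registered stub P2 (`Stubs.stub_passivityCollisional`, verbatim): the `sorry` to be discharged. -/
theorem stub_passivityCollisional :
  ∀ (η₀ : ℝ) (F : ℝ → ℝ), EosBand η₀ F → ∀ η₁ : ℝ, 0 < η₁ → η₁ < η₀ →
  ∀ (a₀ θ₀ : T3 → ℝ) (u₀ : T3 → V3), Continuous a₀ → Continuous θ₀ → Continuous u₀ →
    (∀ x, 0 < a₀ x) → (∀ x, 0 < θ₀ x) → ∃ σ₀ : ℝ, 0 < σ₀ ∧ ∀ σ : ℝ, 0 < σ → σ < σ₀ →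
    ∀ (T : ℝ) (ρ θ : ℝ → T3 → ℝ) (u : ℝ → T3 → V3), IsHardSphereEulerSolution σ T ρ u θ →
    ∀ Φ : (N : ℕ) → Flow σ N,
    TendstoHydroFieldsAt (fun N => localGibbsLaw σ a₀ u₀ θ₀ N (Φ N)) Φ ρ u θ 0 → 0 < T →
    ∀ τ : ℝ, 0 < τ → ∀ φ : ℝ → T3 → ℝ, Literature.Analysis.FunctionSpaces.Torus.IsSmoothSpaceTimeOn Set.univ φ →
    (∀ s x, 0 ≤ φ s x) → (∃ τ' : ℝ, τ' < τ ∧ ∀ s, τ' ≤ s → ∀ x, φ s x = 0) →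
    ∀ c : ℝ, 0 < c →
    ∀ η δ : ℝ, 0 < η → 0 < δ → ∃ r₀ : ℝ, 0 < r₀ ∧ ∀ r : ℝ, 0 < r → r < r₀ → ∃ N₀ : ℕ, ∀ N : ℕ, N₀ ≤ N →
      localGibbsLaw σ a₀ u₀ θ₀ N (Φ N)
          {z | Regular σ r τ c η₁ (Φ N) z ∧ T₂ σ r τ φ (Φ N) z < -η}
        ≤ ENNReal.ofReal δ := by
  sorry

/-- **P3 · passivity of the heat currents** (`stub_passivityThermal`; the card's PassivityT3 = (N1) weak cubic
heat-flux closure + (N2) vanishing collisional heat transfer; the line's HARDEST stub).  In the crux's frame: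
`P( Regular ∧ T3 < −η ) ≤ δ` eventually — the kinetic cubic current `q^kin_r` and the collisional energy transfer `q^c_r`
pair non-negatively (asymptotically) with `∇(φ/θ_r)`.  WHY PLAUSIBLE / WHY HARD: pre-shock the target is `T3 → 0`:
`∫∫∇(φ/θ_r)·q^kin_r → 0` is a WEAK-FORM CUBIC closure (NY03 Assumption II.1 territory, HighMomentumCutoff class) that
KineticEnergyTails does NOT give (card's `c/V³` stream: tail energy `c/V → 0`, tail energy FLUX `c/2`), so the crux
itself implies it and any proof must pay it; filed producers: card termwise-even-channel-mesoscale (KL-Maxwellisation at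
rate `Kn^{1/(1+ε)}` + a polynomial 6th-moment bound instead of cubic UI) and the EnergyCurrentTails / EnergyFluxLocality
items of other routes (9235, 4516); the collisional half is the J-even energy-transfer statistic with vanishing Enskog
value (`n̂ ↦ −n̂` symmetry of the Maxwellian contact law; second half of old stmt-8225), same machinery as crux 3.
Post-shock sign mechanism: Fourier, `φ q·∇(1/θ_r) ≥ 0` for `q` anti-parallel to `∇θ_r` through the layer.  On Regular
the weight `∇(φ/θ_r)` is bounded by `C(c, ke)/r` (triage r1-1: "T3 needs a temperature floor and `|∇θ_r| ≤ C/r`").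
No rate, no exponential moment is asked (negatives 14607 respected).  Size: open-problem.
Leans on: `KineticEnergyTails` (13087, insufficient alone), `CollisionTightness` (13085), `EvenStressEnskog`-type
even-mark machinery for `q^c_r`, AprioriBounds-type moment items (StiffCollisionalRelaxation K3) for `q^kin_r`. -/
def Stubs.stub_passivityThermal : Prop :=
  ∀ (a₀ θ₀ : T3 → ℝ) (u₀ : T3 → V3), Continuous a₀ → Continuous θ₀ → Continuous u₀ →
    (∀ x, 0 < a₀ x) → (∀ x, 0 < θ₀ x) → ∃ σ₀ : ℝ, 0 < σ₀ ∧ ∀ σ : ℝ, 0 < σ → σ < σ₀ →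
    ∀ (T : ℝ) (ρ θ : ℝ → T3 → ℝ) (u : ℝ → T3 → V3), IsHardSphereEulerSolution σ T ρ u θ →
    ∀ Φ : (N : ℕ) → Flow σ N,
    TendstoHydroFieldsAt (fun N => localGibbsLaw σ a₀ u₀ θ₀ N (Φ N)) Φ ρ u θ 0 → 0 < T →
    ∀ τ : ℝ, 0 < τ → ∀ φ : ℝ → T3 → ℝ, Literature.Analysis.FunctionSpaces.Torus.IsSmoothSpaceTimeOn Set.univ φ →
    (∀ s x, 0 ≤ φ s x) → (∃ τ' : ℝ, τ' < τ ∧ ∀ s, τ' ≤ s → ∀ x, φ s x = 0) →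
    ∀ c η₁ : ℝ, 0 < c →
    ∀ η δ : ℝ, 0 < η → 0 < δ → ∃ r₀ : ℝ, 0 < r₀ ∧ ∀ r : ℝ, 0 < r → r < r₀ → ∃ N₀ : ℕ, ∀ N : ℕ, N₀ ≤ N →
      localGibbsLaw σ a₀ u₀ θ₀ N (Φ N)
          {z | Regular σ r τ c η₁ (Φ N) z ∧ T₃ σ r τ φ (Φ N) z < -η}
        ≤ ENNReal.ofReal δ

/-- Registered stub P3 (`Stubs.stub_passivityThermal`, verbatim): the `sorry` to be discharged. -/
theorem stub_passivityThermal :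
  ∀ (a₀ θ₀ : T3 → ℝ) (u₀ : T3 → V3), Continuous a₀ → Continuous θ₀ → Continuous u₀ →
    (∀ x, 0 < a₀ x) → (∀ x, 0 < θ₀ x) → ∃ σ₀ : ℝ, 0 < σ₀ ∧ ∀ σ : ℝ, 0 < σ → σ < σ₀ →
    ∀ (T : ℝ) (ρ θ : ℝ → T3 → ℝ) (u : ℝ → T3 → V3), IsHardSphereEulerSolution σ T ρ u θ →
    ∀ Φ : (N : ℕ) → Flow σ N,
    TendstoHydroFieldsAt (fun N => localGibbsLaw σ a₀ u₀ θ₀ N (Φ N)) Φ ρ u θ 0 → 0 < T →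
    ∀ τ : ℝ, 0 < τ → ∀ φ : ℝ → T3 → ℝ, Literature.Analysis.FunctionSpaces.Torus.IsSmoothSpaceTimeOn Set.univ φ →
    (∀ s x, 0 ≤ φ s x) → (∃ τ' : ℝ, τ' < τ ∧ ∀ s, τ' ≤ s → ∀ x, φ s x = 0) →
    ∀ c η₁ : ℝ, 0 < c →
    ∀ η δ : ℝ, 0 < η → 0 < δ → ∃ r₀ : ℝ, 0 < r₀ ∧ ∀ r : ℝ, 0 < r → r < r₀ → ∃ N₀ : ℕ, ∀ N : ℕ, N₀ ≤ N →
      localGibbsLaw σ a₀ u₀ θ₀ N (Φ N)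
          {z | Regular σ r τ c η₁ (Φ N) z ∧ T₃ σ r τ φ (Φ N) z < -η}
        ≤ ENNReal.ofReal δ := by
  sorry

/-! ## Consistency: the registered theorems ARE the statement `Prop`s (syntactically, `:= stub_*`) -/

theorem initialLayer_holds : Stubs.stub_initialLayer := stub_initialLayer
theorem ledger_holds : Stubs.stub_ledger := stub_ledger
theorem regularRange_holds : Stubs.stub_regularRange := stub_regularRange
theorem passivityKinetic_holds : Stubs.stub_passivityKinetic := stub_passivityKinetic
theorem passivityCollisional_holds : Stubs.stub_passivityCollisional := stub_passivityCollisional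
theorem passivityThermal_holds : Stubs.stub_passivityThermal := stub_passivityThermal

/-! ## Composition (sorry-free): the six stubs and the EOS item imply the crux BY NAME -/

/-- **`LocalSecondLaw` from the ledger line.**  Pure bookkeeping, no `sorry`: the EOS band `(η₀, F)` from
`HsEosLowDensity`, cap `η₁ := η₀/2`; `σ₀ := min` of the five frame thresholds; given the crux's data and `(η, δ)`, the
floor `c` from F at `δ/5`, then `r₀ := min` of the five resolutions (B and P1–P3 run at `(η/4, δ/5)`), `N₀ := max`; for
`N ≥ N₀` the crux event — rewritten DEFINITIONALLY through `entropyFunctional` (`change`) — is contained in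
`{Euler bdry < particle bdry − η/4} ∪ Regularᶜ ∪ ⋃ᵢ{Regular ∧ Tᵢ < −η/4}`: on the complement the pathwise ledger L gives
`I + ∫H(ρ(0),θ(0))φ(0) ≥ T1 + T2 + T3 − η/4 ≥ −η`.  Union bound (`measure_mono`, `measure_union_le`, `ENNReal.ofReal_add`). -/
theorem LocalSecondLaw_of (hEos : JParityClosure.HsEosLowDensity) (hF : Stubs.stub_regularRange)
    (hP1 : Stubs.stub_passivityKinetic) (hP2 : Stubs.stub_passivityCollisional)
    (hP3 : Stubs.stub_passivityThermal) :
    JParityClosure.LocalSecondLaw := by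
  -- B and L are CLOSED (landed tree theorems, cycle 1): discharged here, no longer hypotheses
  have hB : Stubs.stub_initialLayer := initialLayer_holds
  have hL : Stubs.stub_ledger := ledger_holds
  obtain ⟨η₀, hη₀, F, hFan, hFeq, -, -, -⟩ := hEos
  have hband : EosBand η₀ F := ⟨hη₀, hFan, hFeq⟩
  have hη₁ : (0 : ℝ) < η₀ / 2 := by positivity
  have hη₁lt : η₀ / 2 < η₀ := by linarith
  intro a₀ θ₀ u₀ ha hθ hu ha0 hθ0
  obtain ⟨σB, hσB, HB⟩ := hB η₀ F hband a₀ θ₀ u₀ ha hθ hu ha0 hθ0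
  obtain ⟨σF, hσF, HF⟩ := hF (η₀ / 2) hη₁ a₀ θ₀ u₀ ha hθ hu ha0 hθ0
  obtain ⟨σ₁, hσ₁, H1⟩ := hP1 a₀ θ₀ u₀ ha hθ hu ha0 hθ0
  obtain ⟨σ₂, hσ₂, H2⟩ := hP2 η₀ F hband (η₀ / 2) hη₁ hη₁lt a₀ θ₀ u₀ ha hθ hu ha0 hθ0
  obtain ⟨σ₃, hσ₃, H3⟩ := hP3 a₀ θ₀ u₀ ha hθ hu ha0 hθ0
  refine ⟨min (min σB σF) (min σ₁ (min σ₂ σ₃)),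
    lt_min (lt_min hσB hσF) (lt_min hσ₁ (lt_min hσ₂ hσ₃)), ?_⟩
  intro σ hσ hσlt T ρ θ u hE Φ h0 hT τ hτ φ hφ hφ0 hsupp η δ hη hδ
  have hσB' : σ < σB := lt_of_lt_of_le hσlt ((min_le_left _ _).trans (min_le_left _ _))
  have hσF' : σ < σF := lt_of_lt_of_le hσlt ((min_le_left _ _).trans (min_le_right _ _))
  have hσ1' : σ < σ₁ := lt_of_lt_of_le hσlt ((min_le_right _ _).trans (min_le_left _ _))
  have hσ2' : σ < σ₂ :=
    lt_of_lt_of_le hσlt ((min_le_right _ _).trans ((min_le_right _ _).trans (min_le_left _ _)))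
  have hσ3' : σ < σ₃ :=
    lt_of_lt_of_le hσlt ((min_le_right _ _).trans ((min_le_right _ _).trans (min_le_right _ _)))
  have hη4 : (0 : ℝ) < η / 4 := by positivity
  have hδ5 : (0 : ℝ) < δ / 5 := by positivity
  -- the floor, chosen before the resolution
  obtain ⟨c, hc, rF, hrF, HF'⟩ := HF σ hσ hσF' T ρ θ u hE Φ h0 hT τ hτ (δ / 5) hδ5
  -- the resolutions
  obtain ⟨rB, hrB, HB'⟩ := HB σ hσ hσB' T ρ θ u hE Φ h0 hT φ hφ hφ0 (η / 4) (δ / 5) hη4 hδ5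
  obtain ⟨r₁, hr₁, H1'⟩ :=
    H1 σ hσ hσ1' T ρ θ u hE Φ h0 hT τ hτ φ hφ hφ0 hsupp c (η₀ / 2) hc (η / 4) (δ / 5) hη4 hδ5
  obtain ⟨r₂, hr₂, H2'⟩ :=
    H2 σ hσ hσ2' T ρ θ u hE Φ h0 hT τ hτ φ hφ hφ0 hsupp c hc (η / 4) (δ / 5) hη4 hδ5
  obtain ⟨r₃, hr₃, H3'⟩ :=
    H3 σ hσ hσ3' T ρ θ u hE Φ h0 hT τ hτ φ hφ hφ0 hsupp c (η₀ / 2) hc (η / 4) (δ / 5) hη4 hδ5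
  refine ⟨min (min rB rF) (min r₁ (min r₂ r₃)),
    lt_min (lt_min hrB hrF) (lt_min hr₁ (lt_min hr₂ hr₃)), ?_⟩
  intro r hr hrlt
  have hrB' : r < rB := lt_of_lt_of_le hrlt ((min_le_left _ _).trans (min_le_left _ _))
  have hrF' : r < rF := lt_of_lt_of_le hrlt ((min_le_left _ _).trans (min_le_right _ _))
  have hr1' : r < r₁ := lt_of_lt_of_le hrlt ((min_le_right _ _).trans (min_le_left _ _))
  have hr2' : r < r₂ :=
    lt_of_lt_of_le hrlt ((min_le_right _ _).trans ((min_le_right _ _).trans (min_le_left _ _)))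
  have hr3' : r < r₃ :=
    lt_of_lt_of_le hrlt ((min_le_right _ _).trans ((min_le_right _ _).trans (min_le_right _ _)))
  obtain ⟨NB, HB''⟩ := HB' r hr hrB'
  obtain ⟨NF, HF''⟩ := HF' r hr hrF'
  obtain ⟨N₁, H1''⟩ := H1' r hr hr1'
  obtain ⟨N₂, H2''⟩ := H2' r hr hr2'
  obtain ⟨N₃, H3''⟩ := H3' r hr hr3'
  refine ⟨max (max NB NF) (max N₁ (max N₂ N₃)), ?_⟩
  intro N hN
  have hNB : NB ≤ N := ((le_max_left _ _).trans (le_max_left _ _)).trans hN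
  have hNF : NF ≤ N := ((le_max_right _ _).trans (le_max_left _ _)).trans hN
  have hN1 : N₁ ≤ N := ((le_max_left _ _).trans (le_max_right _ _)).trans hN
  have hN2 : N₂ ≤ N :=
    (((le_max_left _ _).trans (le_max_right _ _)).trans (le_max_right _ _)).trans hN
  have hN3 : N₃ ≤ N :=
    (((le_max_right _ _).trans (le_max_right _ _)).trans (le_max_right _ _)).trans hN
  -- the five probabilistic inputs at this `N`
  have EB := HB'' N hNB
  have EF := HF'' N hNF
  have E1 := H1'' N hN1
  have E2 := H2'' N hN2
  have E3 := H3'' N hN3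
  -- the deterministic ledger at this `N`
  have hLed : ∀ z : Phase N, Regular σ r τ c (η₀ / 2) (Φ N) z →
      T₁ σ r τ φ (Φ N) z + T₂ σ r τ φ (Φ N) z + T₃ σ r τ φ (Φ N) z ≤
        entropyFunctional σ r τ φ (Φ N) z + bdry σ r (φ 0) (Φ N) z :=
    fun z hz => hL η₀ F hband (η₀ / 2) c σ r τ hη₁lt hc hσ hr hτ φ hφ hφ0 hsupp N (Φ N) z hz
  -- rewrite the crux event through the named functional (definitional)
  change localGibbsLaw σ a₀ u₀ θ₀ N (Φ N)
      {z | entropyFunctional σ r τ φ (Φ N) z + ∫ x : T3, Hs σ (ρ 0 x) (θ 0 x) * φ 0 x < -η}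
    ≤ ENNReal.ofReal δ
  -- event inclusion
  have hsub : {z | entropyFunctional σ r τ φ (Φ N) z + ∫ x : T3, Hs σ (ρ 0 x) (θ 0 x) * φ 0 x < -η} ⊆
      {z | (∫ x : T3, Hs σ (ρ 0 x) (θ 0 x) * φ 0 x) < bdry σ r (φ 0) (Φ N) z - η / 4} ∪
        {z | ¬ Regular σ r τ c (η₀ / 2) (Φ N) z} ∪
        {z | Regular σ r τ c (η₀ / 2) (Φ N) z ∧ T₁ σ r τ φ (Φ N) z < -(η / 4)} ∪
        {z | Regular σ r τ c (η₀ / 2) (Φ N) z ∧ T₂ σ r τ φ (Φ N) z < -(η / 4)} ∪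
        {z | Regular σ r τ c (η₀ / 2) (Φ N) z ∧ T₃ σ r τ φ (Φ N) z < -(η / 4)} := by
    intro z hz
    simp only [Set.mem_setOf_eq] at hz
    by_contra hcon
    simp only [Set.mem_union, Set.mem_setOf_eq, not_or, not_and, not_lt, not_not] at hcon
    obtain ⟨⟨⟨⟨hB0, hReg⟩, h10⟩, h20⟩, h30⟩ := hcon
    have h1 := h10 hReg
    have h2 := h20 hReg
    have h3 := h30 hReg
    have hL0 := hLed z hReg
    linarith
  calc localGibbsLaw σ a₀ u₀ θ₀ N (Φ N)
        {z | entropyFunctional σ r τ φ (Φ N) z + ∫ x : T3, Hs σ (ρ 0 x) (θ 0 x) * φ 0 x < -η}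
      ≤ localGibbsLaw σ a₀ u₀ θ₀ N (Φ N)
          ({z | (∫ x : T3, Hs σ (ρ 0 x) (θ 0 x) * φ 0 x) < bdry σ r (φ 0) (Φ N) z - η / 4} ∪
            {z | ¬ Regular σ r τ c (η₀ / 2) (Φ N) z} ∪
            {z | Regular σ r τ c (η₀ / 2) (Φ N) z ∧ T₁ σ r τ φ (Φ N) z < -(η / 4)} ∪
            {z | Regular σ r τ c (η₀ / 2) (Φ N) z ∧ T₂ σ r τ φ (Φ N) z < -(η / 4)} ∪
            {z | Regular σ r τ c (η₀ / 2) (Φ N) z ∧ T₃ σ r τ φ (Φ N) z < -(η / 4)}) :=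
        measure_mono hsub
    _ ≤ localGibbsLaw σ a₀ u₀ θ₀ N (Φ N)
          ({z | (∫ x : T3, Hs σ (ρ 0 x) (θ 0 x) * φ 0 x) < bdry σ r (φ 0) (Φ N) z - η / 4} ∪
            {z | ¬ Regular σ r τ c (η₀ / 2) (Φ N) z} ∪
            {z | Regular σ r τ c (η₀ / 2) (Φ N) z ∧ T₁ σ r τ φ (Φ N) z < -(η / 4)} ∪
            {z | Regular σ r τ c (η₀ / 2) (Φ N) z ∧ T₂ σ r τ φ (Φ N) z < -(η / 4)}) +
        localGibbsLaw σ a₀ u₀ θ₀ N (Φ N)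
          {z | Regular σ r τ c (η₀ / 2) (Φ N) z ∧ T₃ σ r τ φ (Φ N) z < -(η / 4)} :=
        measure_union_le _ _
    _ ≤ localGibbsLaw σ a₀ u₀ θ₀ N (Φ N)
          ({z | (∫ x : T3, Hs σ (ρ 0 x) (θ 0 x) * φ 0 x) < bdry σ r (φ 0) (Φ N) z - η / 4} ∪
            {z | ¬ Regular σ r τ c (η₀ / 2) (Φ N) z} ∪
            {z | Regular σ r τ c (η₀ / 2) (Φ N) z ∧ T₁ σ r τ φ (Φ N) z < -(η / 4)}) +
        localGibbsLaw σ a₀ u₀ θ₀ N (Φ N)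
          {z | Regular σ r τ c (η₀ / 2) (Φ N) z ∧ T₂ σ r τ φ (Φ N) z < -(η / 4)} +
        localGibbsLaw σ a₀ u₀ θ₀ N (Φ N)
          {z | Regular σ r τ c (η₀ / 2) (Φ N) z ∧ T₃ σ r τ φ (Φ N) z < -(η / 4)} :=
        add_le_add (measure_union_le _ _) le_rfl
    _ ≤ localGibbsLaw σ a₀ u₀ θ₀ N (Φ N)
          ({z | (∫ x : T3, Hs σ (ρ 0 x) (θ 0 x) * φ 0 x) < bdry σ r (φ 0) (Φ N) z - η / 4} ∪
            {z | ¬ Regular σ r τ c (η₀ / 2) (Φ N) z}) +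
        localGibbsLaw σ a₀ u₀ θ₀ N (Φ N)
          {z | Regular σ r τ c (η₀ / 2) (Φ N) z ∧ T₁ σ r τ φ (Φ N) z < -(η / 4)} +
        localGibbsLaw σ a₀ u₀ θ₀ N (Φ N)
          {z | Regular σ r τ c (η₀ / 2) (Φ N) z ∧ T₂ σ r τ φ (Φ N) z < -(η / 4)} +
        localGibbsLaw σ a₀ u₀ θ₀ N (Φ N)
          {z | Regular σ r τ c (η₀ / 2) (Φ N) z ∧ T₃ σ r τ φ (Φ N) z < -(η / 4)} :=
        add_le_add (add_le_add (measure_union_le _ _) le_rfl) le_rfl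
    _ ≤ localGibbsLaw σ a₀ u₀ θ₀ N (Φ N)
          {z | (∫ x : T3, Hs σ (ρ 0 x) (θ 0 x) * φ 0 x) < bdry σ r (φ 0) (Φ N) z - η / 4} +
        localGibbsLaw σ a₀ u₀ θ₀ N (Φ N) {z | ¬ Regular σ r τ c (η₀ / 2) (Φ N) z} +
        localGibbsLaw σ a₀ u₀ θ₀ N (Φ N)
          {z | Regular σ r τ c (η₀ / 2) (Φ N) z ∧ T₁ σ r τ φ (Φ N) z < -(η / 4)} +
        localGibbsLaw σ a₀ u₀ θ₀ N (Φ N)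
          {z | Regular σ r τ c (η₀ / 2) (Φ N) z ∧ T₂ σ r τ φ (Φ N) z < -(η / 4)} +
        localGibbsLaw σ a₀ u₀ θ₀ N (Φ N)
          {z | Regular σ r τ c (η₀ / 2) (Φ N) z ∧ T₃ σ r τ φ (Φ N) z < -(η / 4)} :=
        add_le_add (add_le_add (add_le_add (measure_union_le _ _) le_rfl) le_rfl) le_rfl
    _ ≤ ENNReal.ofReal (δ / 5) + ENNReal.ofReal (δ / 5) + ENNReal.ofReal (δ / 5) +
          ENNReal.ofReal (δ / 5) + ENNReal.ofReal (δ / 5) :=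
        add_le_add (add_le_add (add_le_add (add_le_add EB EF) E1) E2) E3
    _ = ENNReal.ofReal δ := by
        have h2 : (0 : ℝ) ≤ δ / 5 + δ / 5 := by positivity
        have h3 : (0 : ℝ) ≤ δ / 5 + δ / 5 + δ / 5 := by positivity
        have h4 : (0 : ℝ) ≤ δ / 5 + δ / 5 + δ / 5 + δ / 5 := by positivity
        rw [← ENNReal.ofReal_add hδ5.le hδ5.le, ← ENNReal.ofReal_add h2 hδ5.le,
          ← ENNReal.ofReal_add h3 hδ5.le, ← ENNReal.ofReal_add h4 hδ5.le]
        congr 1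
        ring

/-- Wiring check: the registered stubs feed `LocalSecondLaw_of` exactly as stated, and the EOS hypothesis is DISCHARGED
by the tree theorem `Theorems.hsEosLowDensity_proof` (p75216; `ImplosionDichotomy.HsEosLowDensity` and
`JParityClosure.HsEosLowDensity` have identical bodies) — an `example`, so that `LocalSecondLaw_of` stays the file's only
theorem concluding the crux. -/
example : JParityClosure.LocalSecondLaw :=
  LocalSecondLaw_of Summit.AtomisticToContinuum.HydrodynamicLimit.Theorems.hsEosLowDensity_proof
    stub_regularRange stub_passivityKinetic stub_passivityCollisional stub_passivityThermal

/-! ## Checks against the landed `Negative/*` lemmas (imported above; all `example`s)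

No stub is an instance of a refuted variant: the tie is kept (B, F, P1–P3), the support condition is kept (L, P1–P3), the
limit order `∃ r₀ ∀ r ∃ N₀ ∀ N` is kept everywhere (`c` of F is chosen before `r₀`, `N₀` after `r`), and no positive gap is
claimed (every passivity is `≥ −η`). -/

/-- LOAD-BEARING `t = 0` LLN (`Negative/FalseWithoutLLN.lean`): consumed by `stub_initialLayer`. -/
example : ¬ LocalSecondLawWithoutLLN := localSecondLaw_false_without_lln

/-- LOAD-BEARING support condition (`Negative/FalseWithoutSupport.lean`): consumed by `stub_ledger` (no terminal
boundary term in the Stieltjes integration by parts). -/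
example : ¬ LocalSecondLawWithoutSupport := localSecondLaw_false_without_support

/-- TIGHTNESS at global equilibrium (`Negative/Tightness.lean`): no `c`-gap; the passivities claim `Tᵢ ≥ −η` only. -/
example {c : ℝ} (hc : 0 < c) : ¬ LocalSecondLawGapAt c := not_localSecondLawGapAt hc
example : ¬ LocalSecondLawStrictGap := not_localSecondLawStrictGap

/-- LIMIT ORDER (`Negative/RAfterN.lean`): `∃ r₀` after `∀ N` is false; every stub keeps `N₀ = N₀(r)`, and F is
(correctly) unprovable for `2r < ε_N`. -/
example : ¬ LocalSecondLawRAfterN := not_localSecondLawRAfterN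

/-- VOCABULARY BRIDGE (`rfl`): the boundary statistic of the line at a good point is the landed pieces of the crux
functional read at `Φ₀ z`. -/
example (σ r : ℝ) (φ₀ : T3 → ℝ) (Φ : Flow σ N) (z : Phase N) :
    bdry σ r φ₀ Φ z = ∫ x : T3, Hs σ (rhoC r (Φ.flow 0 z) x) (thetaC r (Φ.flow 0 z) x) * φ₀ x := rfl

/-! ## §Equilibrium — SIDE COMPOSITION (leads c2/c3): the crux body VERBATIM at constant profiles — LANDED

Global equilibrium (constant profiles `(a, ū, Θ)`, homogeneous local Gibbs law
`lawC σ a Θ ū N Φ = localGibbsLaw σ (fun _ => a) (fun _ => ū) (fun _ => Θ) N Φ`), every horizon `τ`, the full hard-sphere entropy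
incl. `f_ex`, the guard, and the filed limit order.  The composition and all nine equilibrium stubs are in tree (namespace
`…Theorems.LocalSecondLawEquilibrium`): `eq_detIdentity` (DetIdentity p128351), `eq_pinning` (Pinning), `eq_uniformLLN` (UniformLLN),
`eq_supDensity` (SupDensity), `eq_timeAverage` (TimeAverage p134943; reshaped to a measurable majorant), `eq_modulus` (Modulus),
`eq_majorant` (Majorant), `eq_energyMoment` (EnergyMoment p134048), `eq_coldBalls` (ColdBallsAssembly p135356), `eq_uniformMarginal`
(UniformMarginal; OneParticleMarginal p133656) and the registered composition stub `localSecondLaw_const`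
(`Theorems/JParityClosureLocalSecondLawEquilibriumConst.lean`, p135664); its byte-for-byte crux-text form (constancy instead of
continuity of the data) is the registered stub `localSecondLaw_constData` (`…EquilibriumConstData.lean`).  Below the instance is
re-exported verbatim (registered signature of `localSecondLaw_const`). -/

section Equilibrium

open Summit.AtomisticToContinuum.HydrodynamicLimit.Theorems.LocalSecondLawEquilibrium

/-- **The local second law at global equilibrium** (registered stub `localSecondLaw_const`, LANDED): the crux body verbatim at
constant profiles, for every horizon `τ`.  Re-export of the tree theorem. -/
theorem localSecondLaw_const_holds : ∀ (a Θ : ℝ) (ū : V3), 0 < a → 0 < Θ → ∃ σ₀ : ℝ, 0 < σ₀ ∧ ∀ σ : ℝ, 0 < σ → σ < σ₀ → ∀ (T : ℝ) (ρ θ : ℝ → T3 → ℝ) (u : ℝ → T3 → V3), IsHardSphereEulerSolution σ T ρ u θ → ∀ Φ : (N : ℕ) → Flow σ N, TendstoHydroFieldsAt (fun N => lawC σ a Θ ū N (Φ N)) Φ ρ u θ 0 → 0 < T → ∀ τ : ℝ, 0 < τ → ∀ φ : ℝ → T3 → ℝ, Literature.Analysis.FunctionSpaces.Torus.IsSmoothSpaceTimeOn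 Set.univ φ → (∀ s x, 0 ≤ φ s x) → (∃ τ' : ℝ, τ' < τ ∧ ∀ s, τ' ≤ s → ∀ x, φ s x = 0) → ∀ η δ : ℝ, 0 < η → 0 < δ → ∃ r₀ : ℝ, 0 < r₀ ∧ ∀ r : ℝ, 0 < r → r < r₀ → ∃ N₀ : ℕ, ∀ N : ℕ, N₀ ≤ N → lawC σ a Θ ū N (Φ N) {z | entropyFunctional σ r τ φ (Φ N) z + ∫ x : T3, Hs σ (ρ 0 x) (θ 0 x) * φ 0 x < -η} ≤ ENNReal.ofReal δ :=
  Summit.AtomisticToContinuum.HydrodynamicLimit.Theorems.LocalSecondLawEquilibrium.localSecondLaw_const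

end Equilibrium

end Summit.AtomisticToContinuum.HydrodynamicLimit.Cruxes.LocalSecondLaw.ExactEntropyLedgerThreePassivities

end
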